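import Summits.QuantumFields.YangMills.Theorems.FemtoTransferGapStrictPositivity
import Summits.QuantumFields.YangMills.Theorems.FemtoTransferGapPhysL2Infinite
import Summits.QuantumFields.YangMills.Theorems.FemtoTransferGapSpectral
import Summits.QuantumFields.YangMills.Theorems.LuscherReductionOneSiteLevelsVariational
import HarnessLib

/-!
# Every min–max transfer value of `SU(2)` Wilson theory is STRICTLY positive: `0 < λ_k(β, L)` for all `k`, `L ≥ 1`, `β > 0`

Support module of the `FemtoTransferGap` group (fleet service by seat ym-infvol-p2; route `LuscherReduction`, bears on crux `RunningReduction`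
stmt-QuantumFields-19978 and crux `OneSiteLevels` stmt-QuantumFields-20007).  From the STRICT positivity of the transfer form
(`FemtoTransferGapStrictPositivity.qform_su2Rep_pos`, Lüscher 1977) and the lower-bound principle `le_levelValue_of_subspace` (a `(k+1)`-dimensional
physical trial space with a uniform Rayleigh floor `s` gives `s ≤ λ_k`):

* §1 (abstract, finite-dimensional compactness).  Two real bilinear forms `B`, `Q` on a real vector space that are strictly positive on the non-zero
  combinations of a finite family `Φ` admit a uniform ratio floor, `∃ s > 0, s·B(v,v) ≤ Q(v,v)` on the span (`exists_pos_mul_le_of_pos`: the ratio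
  `Q/B` is continuous on the unit sphere of coefficient space `Fin n → ℝ`, compact; homogeneity).
* §2 **`levelValue_su2Rep_pos : 0 < β → ∀ k, 0 < levelValue su2Rep L β k`** — trial space = the span of the powers `plaqObs⁰, …, plaqObsᵏ` of the
  scalar part of one plaquette (physical, continuous, linearly independent in `L²`: `PhysL2.linearIndependent_toL2_plaqObsPow`), on which `‖·‖²` is
  definite (continuity + full support of the product Haar measure) and `⟨·,K_β·⟩` strictly positive; hence `secondValue_su2Rep_pos`, and on the femto
  window (`β ≥ 1`) `levelValue_pos_of_window`.
* §3 Consequences: the spectral attainment theorems of `FemtoTransferGapSpectral` WITHOUT their positivity premise —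
  `exists_isPhys_eigenfamily_of_pos`, `exists_isPhys_eigenfamily_dominating_of_pos` (`β > 0`, every `k`): `levelValue su2Rep L β k` IS the `k`-th eigenvalue
  of the zero-flux transfer operator with a physical `l2`-orthonormal exact eigenfamily, unconditionally; so the excitation energies
  `E_k = −log(λ_k/λ_0)` of the femto leaves are finite real numbers for every `k`.

HONEST FRAMING: fixed-lattice functional analysis of the femto rung R2b1; nothing here is infinite volume, a mass gap or Clay.
References: M. Lüscher, Commun. Math. Phys. 54 (1977) 283, §3 [cite: Luscher1977]; M. Reed, B. Simon IV (1978) XIII.1 [cite: ReedSimonIV1978].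
-/

set_option autoImplicit false

noncomputable section

open MeasureTheory Filter Topology Real
open Literature.MathematicalPhysics.QuantumFieldTheory
open Literature.MathematicalPhysics.QuantumLattice
open Literature.Analysis.OperatorTheory.YMMatrixModel
open scoped InnerProductSpace

namespace Summit.QuantumFields.YangMills.Theorems.FemtoTransferGap

/-! ### §1. Finite-dimensional compactness: a uniform ratio floor for two strictly positive forms -/

section Floor

variable {V : Type*} [AddCommGroup V] [Module ℝ V]

/-- The combination map `c ↦ ∑ᵢ cᵢ • Φᵢ` is homogeneous. [folklore] -/
theorem sum_smul_smul {n : ℕ} (Φ : Fin n → V) (t : ℝ) (c : Fin n → ℝ) :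
    ∑ i, (t • c) i • Φ i = t • ∑ i, c i • Φ i := by
  rw [Finset.smul_sum]
  refine Finset.sum_congr rfl fun i _ => ?_
  rw [Pi.smul_apply, smul_eq_mul, mul_smul]

/-- A bilinear form evaluated on combinations is a polynomial in the coefficients: `B(∑cᵢΦᵢ, ∑cⱼΦⱼ) = ∑ᵢ∑ⱼ cᵢcⱼ B(Φᵢ,Φⱼ)`. [folklore] -/
theorem bilin_sum_smul {n : ℕ} (B : V →ₗ[ℝ] V →ₗ[ℝ] ℝ) (Φ : Fin n → V) (c : Fin n → ℝ) :
    B (∑ i, c i • Φ i) (∑ j, c j • Φ j) = ∑ i, ∑ j, c i * c j * B (Φ i) (Φ j) := by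
  simp only [map_sum, map_smul, LinearMap.sum_apply, LinearMap.smul_apply, smul_eq_mul, Finset.mul_sum]
  rw [Finset.sum_comm]
  refine Finset.sum_congr rfl fun i _ => Finset.sum_congr rfl fun j _ => ?_
  ring

/-- The coefficient polynomial of a bilinear form is continuous in the coefficients. [folklore] -/
theorem continuous_bilin_sum_smul {n : ℕ} (B : V →ₗ[ℝ] V →ₗ[ℝ] ℝ) (Φ : Fin n → V) :
    Continuous fun c : Fin n → ℝ => B (∑ i, c i • Φ i) (∑ j, c j • Φ j) := by
  simp_rw [bilin_sum_smul]
  refine continuous_finsetSum _ fun i _ => continuous_finsetSum _ fun j _ => ?_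
  exact ((continuous_apply i).mul (continuous_apply j)).mul continuous_const

/-- Quadratic homogeneity: `B(t•v, t•v) = t² B(v,v)`. [folklore] -/
theorem bilin_smul_smul (B : V →ₗ[ℝ] V →ₗ[ℝ] ℝ) (t : ℝ) (v : V) : B (t • v) (t • v) = t ^ 2 * B v v := by
  simp only [map_smul, LinearMap.smul_apply, smul_eq_mul]; ring

/-- **Uniform ratio floor.**  If two real bilinear forms `B`, `Q` are strictly positive on every non-zero combination of a finite family `Φ`
(in particular the family is independent), then `∃ s > 0, s·B(v,v) ≤ Q(v,v)` for every combination `v = ∑ᵢ cᵢΦᵢ`: the ratio `Q/B` is continuous on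
the compact unit sphere of coefficient space and positive there, and both forms are `2`-homogeneous. [folklore] -/
theorem exists_pos_mul_le_of_pos {n : ℕ} (B Q : V →ₗ[ℝ] V →ₗ[ℝ] ℝ) (Φ : Fin n → V)
    (hB : ∀ c : Fin n → ℝ, c ≠ 0 → 0 < B (∑ i, c i • Φ i) (∑ i, c i • Φ i))
    (hQ : ∀ c : Fin n → ℝ, c ≠ 0 → 0 < Q (∑ i, c i • Φ i) (∑ i, c i • Φ i)) :
    ∃ s : ℝ, 0 < s ∧ ∀ c : Fin n → ℝ, s * B (∑ i, c i • Φ i) (∑ i, c i • Φ i) ≤ Q (∑ i, c i • Φ i) (∑ i, c i • Φ i) := by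
  set f : (Fin n → ℝ) → ℝ := fun c => Q (∑ i, c i • Φ i) (∑ j, c j • Φ j) with hf
  set g : (Fin n → ℝ) → ℝ := fun c => B (∑ i, c i • Φ i) (∑ j, c j • Φ j) with hg
  have hfc : Continuous f := continuous_bilin_sum_smul Q Φ
  have hgc : Continuous g := continuous_bilin_sum_smul B Φ
  -- the degenerate case: no non-zero coefficient vector (then every combination is `0`)
  by_cases hn : n = 0
  · subst hn
    refine ⟨1, one_pos, fun c => ?_⟩
    simp
  -- the unit sphere of coefficient space is compact and non-empty
  set S : Set (Fin n → ℝ) := Metric.sphere 0 1 with hS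
  have hScpt : IsCompact S := isCompact_sphere 0 1
  haveI : Nonempty (Fin n) := ⟨⟨0, Nat.pos_of_ne_zero hn⟩⟩
  have hSne : S.Nonempty := (NormedSpace.sphere_nonempty (E := Fin n → ℝ) (x := 0) (r := 1)).mpr zero_le_one
  have hS0 : ∀ c ∈ S, c ≠ 0 := by
    intro c hc h0
    rw [hS, mem_sphere_zero_iff_norm, h0, norm_zero] at hc
    exact zero_ne_one hc
  -- the ratio is continuous on the sphere and attains its minimum
  have hratio : ContinuousOn (fun c => f c / g c) S :=
    hfc.continuousOn.div hgc.continuousOn fun c hc => (hB c (hS0 c hc)).ne'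
  obtain ⟨c0, hc0S, hmin⟩ := hScpt.exists_isMinOn hSne hratio
  set s : ℝ := f c0 / g c0 with hs
  have hs0 : 0 < s := div_pos (hQ c0 (hS0 c0 hc0S)) (hB c0 (hS0 c0 hc0S))
  refine ⟨s, hs0, fun c => ?_⟩
  by_cases hc : c = 0
  · subst hc
    simp
  -- normalise `c` to the sphere and use homogeneity
  set t : ℝ := ‖c‖ with ht
  have ht0 : 0 < t := norm_pos_iff.mpr hc
  set c' : Fin n → ℝ := t⁻¹ • c with hc'
  have hc'S : c' ∈ S := by
    rw [hS, mem_sphere_zero_iff_norm, hc', norm_smul, norm_inv, norm_norm]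
    exact inv_mul_cancel₀ ht0.ne'
  have hcc : c = t • c' := by rw [hc', smul_smul, mul_inv_cancel₀ ht0.ne', one_smul]
  have hmin' : s ≤ f c' / g c' := hmin hc'S
  have hg' : 0 < g c' := hB c' (hS0 c' hc'S)
  have hfg' : s * g c' ≤ f c' := (le_div_iff₀ hg').mp hmin'
  have hfh : f c = t ^ 2 * f c' := by
    show Q (∑ i, c i • Φ i) (∑ j, c j • Φ j) = t ^ 2 * Q (∑ i, c' i • Φ i) (∑ j, c' j • Φ j)
    rw [hcc, sum_smul_smul, bilin_smul_smul]
  have hgh : g c = t ^ 2 * g c' := by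
    show B (∑ i, c i • Φ i) (∑ j, c j • Φ j) = t ^ 2 * B (∑ i, c' i • Φ i) (∑ j, c' j • Φ j)
    rw [hcc, sum_smul_smul, bilin_smul_smul]
  show s * g c ≤ f c
  rw [hfh, hgh]
  have := mul_le_mul_of_nonneg_left hfg' (sq_nonneg t)
  linarith [this]

end Floor

/-! ### §2. `0 < λ_k(β, L)` for every `k` -/

section LevelsPos

open PhysL2

variable {L : ℕ} [NeZero L]

/-- The first `k+1` plaquette powers `plaqObs⁰, …, plaqObsᵏ` (elements `plaqObsPow i` of the physical subspace) are linearly independent (their `L²`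
classes are, `PhysL2.linearIndependent_toL2_plaqObsPow`). [folklore] -/
theorem linearIndependent_plaqPowFamily (k : ℕ) :
    LinearIndependent ℝ (fun i : Fin (k + 1) => plaqObsPow (L := L) (i : ℕ)) := by
  have h := (linearIndependent_toL2_plaqObsPow (L := L)).comp (fun i : Fin (k + 1) => (i : ℕ)) Fin.val_injective
  exact LinearIndependent.of_comp (toL2 (L := L)) h

/-- A non-zero combination of plaquette powers is a non-zero element of the physical subspace. [folklore] -/
theorem sum_smul_plaqPowFamily_ne_zero (k : ℕ) {c : Fin (k + 1) → ℝ} (hc : c ≠ 0) :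
    ∑ i, c i • plaqObsPow (L := L) ((i : Fin (k + 1)) : ℕ) ≠ 0 := by
  intro h0
  exact hc (funext fun i => Fintype.linearIndependent_iff.mp (linearIndependent_plaqPowFamily (L := L) k) c h0 i)

/-- Combinations of plaquette powers are continuous functions. [folklore] -/
theorem coe_sum_smul_plaqPowFamily (k : ℕ) (c : Fin (k + 1) → ℝ) :
    ((∑ i, c i • plaqObsPow (L := L) ((i : Fin (k + 1)) : ℕ) : physSubmodule L) : GaugeConfig 3 L SU2 → ℝ) = fun U => ∑ i, c i * plaqObs L U ^ (i : ℕ) := by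
  funext U
  rw [Submodule.coe_sum, Finset.sum_apply]
  refine Finset.sum_congr rfl fun i _ => ?_
  simp [plaqObsPow]

/-- Combinations of plaquette powers are continuous functions. [folklore] -/
theorem continuous_sum_smul_plaqPowFamily (k : ℕ) (c : Fin (k + 1) → ℝ) :
    Continuous ((∑ i, c i • plaqObsPow (L := L) ((i : Fin (k + 1)) : ℕ) : physSubmodule L) : GaugeConfig 3 L SU2 → ℝ) := by
  rw [coe_sum_smul_plaqPowFamily]
  exact continuous_finsetSum _ fun i _ => continuous_const.mul (continuous_plaqObs.pow _)

/-- `‖·‖²` is definite on combinations of plaquette powers (continuity + full support of the product Haar measure). [folklore] -/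
theorem l2_sum_smul_plaqPowFamily_pos (k : ℕ) {c : Fin (k + 1) → ℝ} (hc : c ≠ 0) :
    0 < l2 ((∑ i, c i • plaqObsPow (L := L) ((i : Fin (k + 1)) : ℕ) : physSubmodule L) : GaugeConfig 3 L SU2 → ℝ)
      ((∑ i, c i • plaqObsPow (L := L) ((i : Fin (k + 1)) : ℕ) : physSubmodule L) : GaugeConfig 3 L SU2 → ℝ) := by
  set v : physSubmodule L := ∑ i, c i • plaqObsPow (L := L) ((i : Fin (k + 1)) : ℕ) with hv
  have hne : toL2 v ≠ 0 := by
    intro h0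
    have hz := coe_eq_zero_of_toL2_eq_zero (continuous_sum_smul_plaqPowFamily k c) h0
    exact sum_smul_plaqPowFamily_ne_zero k hc (Subtype.ext hz)
  rw [← norm_sq_toL2]
  exact pow_pos (norm_pos_iff.mpr hne) 2

/-- **`0 < λ_k(β, L)` for every level `k`, every `L ≥ 1`, every `β > 0`** (Lüscher 1977 + Courant–Fischer): the `(k+1)`-dimensional physical trial
space spanned by `plaqObs⁰, …, plaqObsᵏ` carries a uniform Rayleigh floor `s > 0` (strict positivity of the transfer form `qform_su2Rep_pos`,
definiteness of `‖·‖²`, compactness `exists_pos_mul_le_of_pos`), and `s ≤ λ_k` by the lower-bound principle `le_levelValue_of_subspace`.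
[cite: Luscher1977, §3] [cite: ReedSimonIV1978, Thm. XIII.1] -/
theorem levelValue_su2Rep_pos {β : ℝ} (hβ : 0 < β) (k : ℕ) : 0 < levelValue su2Rep L β k := by
  set Φ : Fin (k + 1) → physSubmodule L := fun i => plaqObsPow (L := L) (i : ℕ) with hΦ
  -- the two forms on the physical subspace
  set B : physSubmodule L →ₗ[ℝ] physSubmodule L →ₗ[ℝ] ℝ := l2Form L with hB
  set Q : physSubmodule L →ₗ[ℝ] physSubmodule L →ₗ[ℝ] ℝ := (l2Form L).compl₂ (transferOp β) with hQ
  have hQapply : ∀ v : physSubmodule L, Q v v = qform su2Rep β (v : GaugeConfig 3 L SU2 → ℝ) v := fun v => by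
    rw [hQ, LinearMap.compl₂_apply, l2Form_transferOp_right]
  have hBpos : ∀ c : Fin (k + 1) → ℝ, c ≠ 0 → 0 < B (∑ i, c i • Φ i) (∑ i, c i • Φ i) := fun c hc => by
    rw [hB, l2Form_apply]; exact l2_sum_smul_plaqPowFamily_pos k hc
  have hQpos : ∀ c : Fin (k + 1) → ℝ, c ≠ 0 → 0 < Q (∑ i, c i • Φ i) (∑ i, c i • Φ i) := fun c hc => by
    rw [hQapply]
    exact qform_su2Rep_pos hβ (isPhys_coe _) (l2_sum_smul_plaqPowFamily_pos k hc)
  obtain ⟨s, hs, hfloor⟩ := exists_pos_mul_le_of_pos B Q Φ hBpos hQpos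
  -- the trial space as a submodule of functions
  set W : Submodule ℝ (GaugeConfig 3 L SU2 → ℝ) :=
    Submodule.span ℝ (Set.range fun i => ((Φ i : physSubmodule L) : GaugeConfig 3 L SU2 → ℝ)) with hW
  have hli : LinearIndependent ℝ fun i => ((Φ i : physSubmodule L) : GaugeConfig 3 L SU2 → ℝ) :=
    (linearIndependent_plaqPowFamily (L := L) k).map' (physSubmodule L).subtype (Submodule.ker_subtype _)
  have hrank : Module.finrank ℝ W = k + 1 := by
    rw [hW, finrank_span_eq_card hli, Fintype.card_fin]
  -- every element of `W` is the image of a combination in the physical subspace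
  have hmem : ∀ ψ ∈ W, ∃ c : Fin (k + 1) → ℝ, ψ = ((∑ i, c i • Φ i : physSubmodule L) : GaugeConfig 3 L SU2 → ℝ) := by
    intro ψ hψ
    obtain ⟨c, hc⟩ := Submodule.mem_span_range_iff_exists_fun ℝ |>.mp hψ
    refine ⟨c, ?_⟩
    rw [← hc, Submodule.coe_sum]
    simp only [Submodule.coe_smul]
  have hadm : ∀ ψ ∈ W, IsPhys ψ := by
    intro ψ hψ
    obtain ⟨c, rfl⟩ := hmem ψ hψ
    exact isPhys_coe _
  have hl2 : ∀ ψ ∈ W, ψ ≠ 0 → 0 < l2 ψ ψ := by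
    intro ψ hψ hne
    obtain ⟨c, rfl⟩ := hmem ψ hψ
    have hc : c ≠ 0 := by
      rintro rfl
      apply hne
      simp
    exact l2_sum_smul_plaqPowFamily_pos k hc
  have hsW : ∀ ψ ∈ W, s * l2 ψ ψ ≤ qform su2Rep β ψ ψ := by
    intro ψ hψ
    obtain ⟨c, rfl⟩ := hmem ψ hψ
    have h := hfloor c
    rw [hB, l2Form_apply, hQapply] at h
    exact h
  exact lt_of_lt_of_le hs (le_levelValue_of_subspace su2Rep continuous_su2Rep β W hrank hadm hl2 hsW)

/-- `0 < λ₁(β, L)` in `secondValue` form. [cite: Luscher1977, §3] -/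
theorem secondValue_su2Rep_pos {β : ℝ} (hβ : 0 < β) : 0 < secondValue su2Rep L β := by
  rw [← levelValue_one]; exact levelValue_su2Rep_pos hβ 1

/-- On the femto window (`1 ≤ β`) every transfer value is strictly positive. [cite: Luscher1977, §3] -/
theorem levelValue_pos_of_window {lam β : ℝ} (hw : InFemtoWindow lam β L) (k : ℕ) : 0 < levelValue su2Rep L β k :=
  levelValue_su2Rep_pos (zero_lt_one.trans_le hw.1) k

/-! ### §3. Spectral attainment without the positivity premise -/

/-- **Spectral attainment, unconditionally** (`FemtoTransferGapSpectral.exists_isPhys_eigenfamily` with its premise `0 < λ_k` discharged): for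
`β > 0` and EVERY `k` there are physical, `l2`-orthonormal EXACT eigenfunctions `φ₀ … φ_k` of the zero-flux transfer operator with
`K_β φ_j = λ_j φ_j` pointwise, `λ_j = levelValue su2Rep L β j`. [cite: ReedSimonI1980, Thm. VI.16] [cite: ReedSimonIV1978, Thm. XIII.1] [cite: Luscher1977, §3] -/
theorem exists_isPhys_eigenfamily_of_pos {β : ℝ} (hβ : 0 < β) (k : ℕ) :
    ∃ e : Fin (k + 1) → (GaugeConfig 3 L SU2 → ℝ),
      (∀ i, IsPhys (e i)) ∧
      (∀ i l, l2 (e i) (e l) = if i = l then 1 else 0) ∧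
      (∀ i, transferApply β (e i) = levelValue su2Rep L β i • e i) :=
  exists_isPhys_eigenfamily hβ.le k (levelValue_su2Rep_pos hβ k)

/-- **Spectral attainment with Courant–Fischer domination, unconditionally** (`exists_isPhys_eigenfamily_dominating` with its premise discharged).
[cite: ReedSimonI1980, Thm. VI.16] [cite: ReedSimonIV1978, Thm. XIII.1] [cite: Luscher1977, §3] -/
theorem exists_isPhys_eigenfamily_dominating_of_pos {β : ℝ} (hβ : 0 < β) (k : ℕ) :
    ∃ e : Fin (k + 1) → (GaugeConfig 3 L SU2 → ℝ),
      (∀ i, IsPhys (e i)) ∧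
      (∀ i l, l2 (e i) (e l) = if i = l then 1 else 0) ∧
      (∀ i, transferApply β (e i) = levelValue su2Rep L β i • e i) ∧
      (∀ (j : Fin (k + 1)) (ψ : GaugeConfig 3 L SU2 → ℝ), IsPhys ψ → (∀ i : Fin (k + 1), i < j → l2 ψ (e i) = 0) →
        qform su2Rep β ψ ψ ≤ levelValue su2Rep L β j * l2 ψ ψ) :=
  exists_isPhys_eigenfamily_dominating hβ.le k (levelValue_su2Rep_pos hβ k)

end LevelsPos

end Summit.QuantumFields.YangMills.Theorems.FemtoTransferGap

end
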